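import Literature.MathematicalPhysics.QuantumFieldTheory.Balaban1983to89.B6Ineq243TwoLevelBox
import Literature.MathematicalPhysics.QuantumFieldTheory.Balaban1983to89.B4Thm110ZeroBoxMeshOne

/-!
# `Balaban1983to89.B6Ineq243TwoLevelBoxL0` — the LEVEL-0 TWIN of `B6Ineq243TwoLevelBox`: [B6] (2.43)₁,₂ and (2.44)
# for the genuine two-level cube propagator `G′(□)` at EVERY mesh `L^{−j}`, `j ≥ 0` — the binder «1 ≤ k» of the
# original removed, so that the `(0, 1)` two-level cubes of a nested family WITH LEVEL 0 (`Λ₀ = T ∖ Ω₁ ≠ ∅`) are covered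

statement-level skeleton of published theorems with citation tags; proofs where landed; nothing here is a claim about the Yang–Mills mass gap

Source: T. Bałaban, *Propagators and renormalization transformations for lattice gauge theories. II*, Commun. Math.
Phys. **96** (1984) 223–250 [`Balaban1984PropagatorsII`, "B6"], p. 225 [PDF 3] (2.14) «⟨λ, Q′*aQ′λ⟩ =
Σ_{j=0}^{k} Σ_{y∈Λ_j} a_j(Lʲη)^{d−2}|(Q′_jλ)(y)|² … and we assume that (Q′₀λ)(x) = λ(x), x ∈ Λ₀», p. 229 [PDF 7]
«Taking these covers for all j from 0 to k we get a family 𝔇 of cubes □», p. 230 [PDF 8] (2.40)–(2.44) (held text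
`paper:balaban1984-cmp96-propagators-rt-ii` pp. 3, 7, 8); T. Bałaban, *Regularity and decay of lattice Green's
functions*, Commun. Math. Phys. **89** (1983) 571–597 [`Balaban1983RegularityDecay`, "[3]" of B6] — Theorem (1.10),
Lemma 2.4 (2.35) «for arbitrary non-negative integer j», as PROVED at `A = 0` for boxes at every mesh `k ≥ 0` in
`B4Thm110ZeroBoxMeshOne` (`thm110_zero_box_roww_coeff_all`, `thm110_zero_box_deriv_roww_coeff_all`).

## WHY THIS FILE (row G-F3′-L0 of the lit-balaban cell, packet S-B of `lit-balaban-r03/G-F3L0-PLAN.md` §5)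

`B6Ineq243TwoLevelBox` certifies (2.43)₁ (`ineq243_twoLevel_roww` :694), (2.43)₂ (`ineq243_twoLevel_deriv_wsum` :946),
(2.44) (`ineq244_twoLevel` :1385) and their printed value forms for the genuine two-level cube operator at mesh
`n = L^k` with the binder `∀ k, 1 ≤ k →`, inherited from [3] Theorem (1.10) as typed in `B4Thm110ZeroBox` (B4 p. 572
«k is an arbitrary positive integer»).  In a nested family WITH LEVEL 0 (plan §1: level 0 = the index `j = 0` of
(2.14)/(2.19)–(2.20) with a finite lattice-scale weight and `Q′₀ = Q₀ = id`) the cubes meeting `Λ₀` and `Λ₁` carry the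
two-level operator at mesh `L^{−0} = 1` (`j`-blocks = points, `(j+1)`-blocks = `L`-blocks): the `k = 0` member of the
SAME matrix family `twoLevelOp n ℓ a_j a m² M′ Λ` / `gTwoLevel …` (`n = 1`), whose inversion
(`twoLevelOp_mul_gTwoLevel`, `hn : 1 ≤ n`) and deterministic estimates (`gTwoLevel_roww_le`,
`gTwoLevel_deriv_wsum_le`, `kComm_gTwoLevel_pointwise`) are ALREADY mesh-free.  Only the B4 inputs carried `1 ≤ k`;
`B4Thm110ZeroBoxMeshOne` supplies them for all `k ≥ 0`.  This twin therefore re-runs the four short assembly proofs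
of the original VERBATIM with the all-scales inputs — PORT DISCIPLINE of the plan §4: SAME declaration names and
binder order in the namespace `…B6Ineq243TwoLevelBoxL0`, the binder `1 ≤ k →` deleted, every mesh-free declaration
of the original used BY NAME (nothing restated, nothing edited).

## WHAT THIS FILE CERTIFIES (kernel-checked; `A = 0`; theorems only)

For every dimension `d + 1`, `L = ℓ + 1 ≥ 2` and window (`a_j ∈ [a₋, a₊]`, `m² ∈ [0, m²₊]`, `a ∈ [a₂₋, a₂₊]`) there are
constants such that FOR EVERY `k ≥ 0` (mesh `n = L^k`, INCLUDING `n = 1`), every box built of `L`-blocks, every `Λ`: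
* `ineq243_twoLevel_roww` / `_value` / `_dist` — (2.43)₁ `|(G′(□)λ)(x)| ≤ O(1)e^{−δ₀dist(x, supp λ)}|λ|` (weighted rows);
* `ineq243_twoLevel_deriv_wsum` / `_deriv_value` — (2.43)₂ for `∂^{L^{−j}}_μG′(□)`;
* `ineq244_twoLevel` — (2.44) `|(K(h_□)G′(□)h_□λ)(x)| ≤ O(M^{−1})e^{−δ₀|x−y|}|λ|` (block unions `Λ`);
* `ineq243_twoLevel_rowSum_colSum` — the uniform `ℓ^∞`/`ℓ¹` bounds;  §4 non-vacuity at `k = 0` and `k = 1`.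
Not twinned: `ineq243_twoLevel_value_aSeq` (the running `a_j = B1.aSeq a L j` has no `j = 0` member — B1 (2.15)
starts at `a_1 = a`; in the level-0 lane the level-0 weight is a window parameter, plan §1).

## HONEST SCOPE

Exactly that of `B6Ineq243TwoLevelBox` (its header, HONEST SCOPE and DICTIONARY apply verbatim), plus: (i) the `k = 0`
member is the unit-mesh two-level cube (level `j = 0` = points with weight `a_j·δ`, level `1` = `L`-blocks with weight
`a_{j+1}L^{−2}·L^{−(d+1)}`, `a_{j+1} = aNext ℓ a_j a`); whether a given nested family uses this member with these
weights is the consumer's reading of (2.14) at `j = 0` (plan §1, «finite lattice-scale weight», OWNER-confirmed), not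
a claim of this file; (ii) constants depend on `d`, `ℓ` and the window and are `min`/`max`-merges of the `k ≥ 1` and
`k = 0` constants of [3]; (iii) nothing of [B6] beyond the original file's sentences is asserted.

Value = kernel certificate (the level-0-capable forms of (2.43)/(2.44) for the cube lane of [B6] Prop. 2.2), NOT
summit progress: the Yang–Mills / `Summit.QuantumFields` statements are untouched; no Literature fact is minted.
-/

namespace Literature.MathematicalPhysics.QuantumFieldTheory.Balaban1983to89.B6Ineq243TwoLevelBoxL0

open Finset Matrix
open Literature.MathematicalPhysics.QuantumFieldTheory.Balaban1983to89.B4ContourShift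
open Literature.MathematicalPhysics.QuantumFieldTheory.Balaban1983to89.B4Reflection242
open Literature.MathematicalPhysics.QuantumFieldTheory.Balaban1983to89.B4Green242Bridge
open Literature.MathematicalPhysics.QuantumFieldTheory.Balaban1983to89.B4BoxCov237
open Literature.MathematicalPhysics.QuantumFieldTheory.Balaban1983to89.B4Thm110ZeroBox
open Literature.MathematicalPhysics.QuantumFieldTheory.Balaban1983to89.B4Thm110ZeroBoxDeriv
  (wsum wsum_add_le wsum_mul_left abs_sum_mul_le_of_wsum mulVec_sub_mulVec sum_abs_le_wsum)
open Literature.MathematicalPhysics.QuantumFieldTheory.Balaban1983to89.B4Thm110ZeroBoxMeshOne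
  (thm110_zero_box_roww_coeff_all thm110_zero_box_deriv_roww_coeff_all)
open Literature.MathematicalPhysics.QuantumFieldTheory.Balaban1983to89.B6Ineq243TwoLevelBox
open B4Sect5Proof (latticeConst latticeConst_nonneg)

noncomputable section

variable {d : ℕ}

/-! ## §1 (2.43), first quantity, for every mesh `L^{−j}`, `j ≥ 0` -/

/-- **[B6] (2.43), FIRST QUANTITY, FOR THE GENUINE TWO-LEVEL CUBE PROPAGATOR `G′(□)`, AT EVERY MESH `j ≥ 0` —
weighted-row form.**  For every dimension `d + 1`, block size `L = ℓ + 1 ≥ 2` and window (`a_j ∈ [a₋, a₊]`,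
`m² ∈ [0, m²₊]`, `a ∈ [a₂₋, a₂₊]`, `a₋, a₂₋ > 0`) there are `δ′, c′ > 0` such that for EVERY `j ≥ 0` (mesh `L^{−j}`,
`n = L^j`; `j = 0` = the unit-mesh cube of a family with level 0), every point of the window, every box built of
`L`-blocks and every `Λ ⊆ □^{(j)}`:  `Σ_{x′ ∈ □} |G′(□; x, x′)|·e^{δ′|x − x′|_∞/L^j} ≤ c′`.  The original
`B6Ineq243TwoLevelBox.ineq243_twoLevel_roww` with the binder «1 ≤ k» removed: same assembly `gTwoLevel_roww_le`, input
`B4Thm110ZeroBoxMeshOne.thm110_zero_box_roww_coeff_all` ([3] (1.10) at `A = 0` for boxes, all `k ≥ 0`) and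
`B4BoxCov237.cov116_box_finset_decay`. [cite: Balaban1984PropagatorsII, (2.43) p.230; (2.14) p.225 (j = 0 admitted), p.229] -/
theorem ineq243_twoLevel_roww (d ℓ : ℕ) (hℓ : 1 ≤ ℓ) (aminus aplus m2plus a2minus a2plus : ℝ) (ha : 0 < aminus)
    (ha2 : 0 < a2minus) :
    ∃ δ' c' : ℝ, 0 < δ' ∧ 0 < c' ∧ ∀ (k : ℕ) (aj m2 a : ℝ), aminus ≤ aj → aj ≤ aplus → 0 ≤ m2 →
      m2 ≤ m2plus → a2minus ≤ a → a ≤ a2plus → ∀ (M' : Fin (d + 1) → ℕ), (∀ i, 1 ≤ M' i) →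
        ∀ (Λ : Finset ↥(boxDom (fun i => (ℓ + 1) * M' i)))
          (x : ↥(boxDom (fun i => (ℓ + 1) ^ k * ((ℓ + 1) * M' i)))),
          roww δ' ((ℓ + 1) ^ k) (gTwoLevel ((ℓ + 1) ^ k) ℓ aj a m2 M' Λ) x ≤ c' := by
  obtain ⟨δ₀, c₀, hδ₀, hc₀, hG⟩ := thm110_zero_box_roww_coeff_all d ℓ hℓ aminus aplus m2plus ha
  obtain ⟨δ, c, hδ, hc, hC⟩ := cov116_box_finset_decay d ℓ hℓ aminus aplus m2plus a2minus a2plus ha ha2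
  have hδ'pos : 0 < min δ₀ (δ / 2) := lt_min hδ₀ (half_pos hδ)
  have hKn : 0 ≤ latticeConst (d + 1) (δ / 2) := latticeConst_nonneg (d + 1) (half_pos hδ).le
  refine ⟨min δ₀ (δ / 2), c₀ + aplus ^ 2 * (c₀ * (c * Real.exp (min δ₀ (δ / 2)) * latticeConst (d + 1) (δ / 2))
    * c₀), hδ'pos, by positivity, ?_⟩
  intro k aj m2 a h1 h2 h3 h4 h5 h6 M' hM Λ x
  have hn1 : 1 ≤ (ℓ + 1) ^ k := Nat.one_le_pow _ _ (by omega)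
  have hMℓ : ∀ i, 1 ≤ (ℓ + 1) * M' i := fun i => by nlinarith [hM i]
  have haj : 0 < aj := lt_of_lt_of_le ha h1
  have hGz : ∀ z, roww δ₀ ((ℓ + 1) ^ k) (boxOpR ((ℓ + 1) ^ k) aj m2 (fun i => (ℓ + 1) * M' i))⁻¹ z ≤ c₀ :=
    fun z => hG k aj m2 h1 h2 h3 h4 (fun i => (ℓ + 1) * M' i) hMℓ z
  have hCz := (hC ((ℓ + 1) ^ k) hn1 aj m2 a h1 h2 h3 h4 h5 h6 M' hM Λ).2
  calc roww (min δ₀ (δ / 2)) ((ℓ + 1) ^ k) (gTwoLevel ((ℓ + 1) ^ k) ℓ aj a m2 M' Λ) x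
      ≤ c₀ + aj ^ 2 * (c₀ * (c * Real.exp (min δ₀ (δ / 2)) * latticeConst (d + 1) (δ / 2)) * c₀) :=
        gTwoLevel_roww_le hn1 aj a m2 Λ hc₀.le hc.le hδ hδ'pos.le (min_le_left _ _) (min_le_right _ _) hGz hCz x
    _ ≤ c₀ + aplus ^ 2 * (c₀ * (c * Real.exp (min δ₀ (δ / 2)) * latticeConst (d + 1) (δ / 2)) * c₀) := by
        have : aj ^ 2 ≤ aplus ^ 2 := pow_le_pow_left₀ haj.le h2 2
        have h0 : 0 ≤ c₀ * (c * Real.exp (min δ₀ (δ / 2)) * latticeConst (d + 1) (δ / 2)) * c₀ := by positivity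
        nlinarith

/-- **[B6] (2.43), FIRST QUANTITY — THE PRINTED VALUE CLAUSE** at every mesh `j ≥ 0`: with the constants of
`ineq243_twoLevel_roww`, for every `λ : □ → ℝ`, every bound `F ≥ |λ|` and every `D ≤ |x − x′|_∞` on `supp λ`
(fine-lattice units):  `|(G′(□)λ)(x)| ≤ c′e^{−δ′D/L^j}F`. [cite: Balaban1984PropagatorsII, (2.43) p.230] -/
theorem ineq243_twoLevel_value (d ℓ : ℕ) (hℓ : 1 ≤ ℓ) (aminus aplus m2plus a2minus a2plus : ℝ) (ha : 0 < aminus)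
    (ha2 : 0 < a2minus) :
    ∃ δ' c' : ℝ, 0 < δ' ∧ 0 < c' ∧ ∀ (k : ℕ) (aj m2 a : ℝ), aminus ≤ aj → aj ≤ aplus → 0 ≤ m2 →
      m2 ≤ m2plus → a2minus ≤ a → a ≤ a2plus → ∀ (M' : Fin (d + 1) → ℕ), (∀ i, 1 ≤ M' i) →
        ∀ (Λ : Finset ↥(boxDom (fun i => (ℓ + 1) * M' i)))
          (f : ↥(boxDom (fun i => (ℓ + 1) ^ k * ((ℓ + 1) * M' i))) → ℝ) (F D : ℝ), (∀ x', |f x'| ≤ F) →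
          ∀ x : ↥(boxDom (fun i => (ℓ + 1) ^ k * ((ℓ + 1) * M' i))),
            (∀ x', f x' ≠ 0 → D ≤ supNorm (x.1 - x'.1)) →
              |(gTwoLevel ((ℓ + 1) ^ k) ℓ aj a m2 M' Λ *ᵥ f) x|
                ≤ c' * Real.exp (-(δ' * D / (((ℓ + 1) ^ k : ℕ) : ℝ))) * F := by
  obtain ⟨δ', c', hδ', hc', h⟩ := ineq243_twoLevel_roww d ℓ hℓ aminus aplus m2plus a2minus a2plus ha ha2
  refine ⟨δ', c', hδ', hc', ?_⟩
  intro k aj m2 a h1 h2 h3 h4 h5 h6 M' hM Λ f F D hF x hD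
  exact mulVec_le_of_roww hδ'.le _ _ x (h k aj m2 a h1 h2 h3 h4 h5 h6 M' hM Λ x) f hF hD

/-- **THE SAME WITH THE LITERAL `dist(x, supp λ)`** (`dsupp f x`, fine-lattice units), every mesh `j ≥ 0`:
`|(G′(□)λ)(x)| ≤ c′e^{−δ′·dsupp/L^j}·F`. [cite: Balaban1984PropagatorsII, (2.43) p.230] -/
theorem ineq243_twoLevel_dist (d ℓ : ℕ) (hℓ : 1 ≤ ℓ) (aminus aplus m2plus a2minus a2plus : ℝ) (ha : 0 < aminus)
    (ha2 : 0 < a2minus) :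
    ∃ δ' c' : ℝ, 0 < δ' ∧ 0 < c' ∧ ∀ (k : ℕ) (aj m2 a : ℝ), aminus ≤ aj → aj ≤ aplus → 0 ≤ m2 →
      m2 ≤ m2plus → a2minus ≤ a → a ≤ a2plus → ∀ (M' : Fin (d + 1) → ℕ), (∀ i, 1 ≤ M' i) →
        ∀ (Λ : Finset ↥(boxDom (fun i => (ℓ + 1) * M' i)))
          (f : ↥(boxDom (fun i => (ℓ + 1) ^ k * ((ℓ + 1) * M' i))) → ℝ) (F : ℝ), (∀ x', |f x'| ≤ F) →
          ∀ x : ↥(boxDom (fun i => (ℓ + 1) ^ k * ((ℓ + 1) * M' i))),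
            |(gTwoLevel ((ℓ + 1) ^ k) ℓ aj a m2 M' Λ *ᵥ f) x|
              ≤ c' * Real.exp (-(δ' * dsupp f x / (((ℓ + 1) ^ k : ℕ) : ℝ))) * F := by
  obtain ⟨δ', c', hδ', hc', h⟩ := ineq243_twoLevel_value d ℓ hℓ aminus aplus m2plus a2minus a2plus ha ha2
  refine ⟨δ', c', hδ', hc', ?_⟩
  intro k aj m2 a h1 h2 h3 h4 h5 h6 M' hM Λ f F hF x
  exact h k aj m2 a h1 h2 h3 h4 h5 h6 M' hM Λ f F (dsupp f x) hF x fun x' hx' => dsupp_le f x x' hx'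

/-! ## §2 (2.43), second quantity `∂^{L^{−j}}_μG′(□)`, for every mesh `j ≥ 0` -/

/-- **[B6] (2.43), SECOND QUANTITY `∂^{L^{−j}}_μG′(□)`, AT EVERY MESH `j ≥ 0` — weighted form.**  For every
dimension, block size and window there are `δ′, c′ > 0` such that for EVERY `j ≥ 0`, every point of the window, every
box built of `L`-blocks, EVERY `Λ ⊆ □^{(j)}`, every axis `μ` and every pair of fine-lattice neighbours
`x, xe = x + ξe_μ` of `□`:  `Σ_{x′ ∈ □} |ξ^{−1}(G′(□; x + ξe_μ, x′) − G′(□; x, x′))|·e^{δ′|x − x′|_∞/L^j} ≤ c′`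
(`ξ = L^{−j}`).  The original `ineq243_twoLevel_deriv_wsum` with «1 ≤ k» removed: same assembly
`gTwoLevel_deriv_wsum_le`, inputs `thm110_zero_box_deriv_roww_coeff_all`, `thm110_zero_box_roww_coeff_all`,
`cov116_box_finset_decay`. [cite: Balaban1984PropagatorsII, (2.43) p.230; (2.14) p.225 (j = 0 admitted)] -/
theorem ineq243_twoLevel_deriv_wsum (d ℓ : ℕ) (hℓ : 1 ≤ ℓ) (aminus aplus m2plus a2minus a2plus : ℝ)
    (ha : 0 < aminus) (ha2 : 0 < a2minus) :
    ∃ δ' c' : ℝ, 0 < δ' ∧ 0 < c' ∧ ∀ (k : ℕ) (aj m2 a : ℝ), aminus ≤ aj → aj ≤ aplus → 0 ≤ m2 →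
      m2 ≤ m2plus → a2minus ≤ a → a ≤ a2plus → ∀ (M' : Fin (d + 1) → ℕ), (∀ i, 1 ≤ M' i) →
        ∀ (Λ : Finset ↥(boxDom (fun i => (ℓ + 1) * M' i))) (μ : Fin (d + 1))
          (x xe : ↥(boxDom (fun i => (ℓ + 1) ^ k * ((ℓ + 1) * M' i)))), xe.1 = x.1 + Pi.single μ 1 →
          ∑ x', |(((ℓ + 1) ^ k : ℕ) : ℝ) * (gTwoLevel ((ℓ + 1) ^ k) ℓ aj a m2 M' Λ xe x'
                - gTwoLevel ((ℓ + 1) ^ k) ℓ aj a m2 M' Λ x x')|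
              * Real.exp (δ' * supNorm (x.1 - x'.1) / (((ℓ + 1) ^ k : ℕ) : ℝ)) ≤ c' := by
  obtain ⟨δ₀, c₀, hδ₀, hc₀, hG⟩ := thm110_zero_box_roww_coeff_all d ℓ hℓ aminus aplus m2plus ha
  obtain ⟨δ₁, c₁, hδ₁, hc₁, hGD⟩ := thm110_zero_box_deriv_roww_coeff_all d ℓ hℓ aminus aplus m2plus ha
  obtain ⟨δ, c, hδ, hc, hC⟩ := cov116_box_finset_decay d ℓ hℓ aminus aplus m2plus a2minus a2plus ha ha2
  have hδ'pos : 0 < min (min δ₀ δ₁) (δ / 2) := lt_min (lt_min hδ₀ hδ₁) (half_pos hδ)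
  have hKn : 0 ≤ latticeConst (d + 1) (δ / 2) := latticeConst_nonneg (d + 1) (half_pos hδ).le
  refine ⟨min (min δ₀ δ₁) (δ / 2),
    c₁ + aplus ^ 2 * (c₁ * (c * Real.exp (min (min δ₀ δ₁) (δ / 2)) * latticeConst (d + 1) (δ / 2)) * c₀),
    hδ'pos, by positivity, ?_⟩
  intro k aj m2 a h1 h2 h3 h4 h5 h6 M' hM Λ μ x xe hxe
  have hn1 : 1 ≤ (ℓ + 1) ^ k := Nat.one_le_pow _ _ (by omega)
  have hMℓ : ∀ i, 1 ≤ (ℓ + 1) * M' i := fun i => by nlinarith [hM i]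
  have haj : 0 < aj := lt_of_lt_of_le ha h1
  have hGz : ∀ z, roww δ₀ ((ℓ + 1) ^ k) (boxOpR ((ℓ + 1) ^ k) aj m2 (fun i => (ℓ + 1) * M' i))⁻¹ z ≤ c₀ :=
    fun z => hG k aj m2 h1 h2 h3 h4 (fun i => (ℓ + 1) * M' i) hMℓ z
  have hGDx : wsum δ₁ ((ℓ + 1) ^ k) x (fun x' => ((((ℓ + 1) ^ k : ℕ)) : ℝ)
      * ((boxOpR ((ℓ + 1) ^ k) aj m2 (fun i => (ℓ + 1) * M' i))⁻¹ xe x'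
        - (boxOpR ((ℓ + 1) ^ k) aj m2 (fun i => (ℓ + 1) * M' i))⁻¹ x x')) ≤ c₁ :=
    hGD k aj m2 h1 h2 h3 h4 (fun i => (ℓ + 1) * M' i) hMℓ μ x xe hxe
  have hCz := (hC ((ℓ + 1) ^ k) hn1 aj m2 a h1 h2 h3 h4 h5 h6 M' hM Λ).2
  have hmain := gTwoLevel_deriv_wsum_le hn1 aj a m2 Λ hc₀.le hc.le hδ hδ'pos.le
    ((min_le_left _ _).trans (min_le_left _ _)) ((min_le_left _ _).trans (min_le_right _ _))
    (min_le_right _ _) hGz hCz x xe hGDx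
  rw [wsum] at hmain
  refine hmain.trans ?_
  have : aj ^ 2 ≤ aplus ^ 2 := pow_le_pow_left₀ haj.le h2 2
  have h0 : 0 ≤ c₁ * (c * Real.exp (min (min δ₀ δ₁) (δ / 2)) * latticeConst (d + 1) (δ / 2)) * c₀ := by
    positivity
  nlinarith

/-- **[B6] (2.43), SECOND QUANTITY — THE PRINTED VALUE CLAUSE** at every mesh `j ≥ 0`: for every `λ`, every
`F ≥ |λ|`, every pair of neighbours `x, xe = x + ξe_μ` and every `D ≤ |x − x′|_∞` on `supp λ`:
`|ξ^{−1}((G′(□)λ)(x + ξe_μ) − (G′(□)λ)(x))| ≤ c′e^{−δ′D/L^j}F`. [cite: Balaban1984PropagatorsII, (2.43) p.230] -/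
theorem ineq243_twoLevel_deriv_value (d ℓ : ℕ) (hℓ : 1 ≤ ℓ) (aminus aplus m2plus a2minus a2plus : ℝ)
    (ha : 0 < aminus) (ha2 : 0 < a2minus) :
    ∃ δ' c' : ℝ, 0 < δ' ∧ 0 < c' ∧ ∀ (k : ℕ) (aj m2 a : ℝ), aminus ≤ aj → aj ≤ aplus → 0 ≤ m2 →
      m2 ≤ m2plus → a2minus ≤ a → a ≤ a2plus → ∀ (M' : Fin (d + 1) → ℕ), (∀ i, 1 ≤ M' i) →
        ∀ (Λ : Finset ↥(boxDom (fun i => (ℓ + 1) * M' i)))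
          (f : ↥(boxDom (fun i => (ℓ + 1) ^ k * ((ℓ + 1) * M' i))) → ℝ) (F D : ℝ), (∀ x', |f x'| ≤ F) →
          ∀ (μ : Fin (d + 1)) (x xe : ↥(boxDom (fun i => (ℓ + 1) ^ k * ((ℓ + 1) * M' i)))),
            xe.1 = x.1 + Pi.single μ 1 → (∀ x', f x' ≠ 0 → D ≤ supNorm (x.1 - x'.1)) →
              |(((ℓ + 1) ^ k : ℕ) : ℝ) * ((gTwoLevel ((ℓ + 1) ^ k) ℓ aj a m2 M' Λ *ᵥ f) xe
                  - (gTwoLevel ((ℓ + 1) ^ k) ℓ aj a m2 M' Λ *ᵥ f) x)|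
                ≤ c' * Real.exp (-(δ' * D / (((ℓ + 1) ^ k : ℕ) : ℝ))) * F := by
  obtain ⟨δ', c', hδ', hc', h⟩ := ineq243_twoLevel_deriv_wsum d ℓ hℓ aminus aplus m2plus a2minus a2plus ha ha2
  refine ⟨δ', c', hδ', hc', ?_⟩
  intro k aj m2 a h1 h2 h3 h4 h5 h6 M' hM Λ f F D hF μ x xe hxe hD
  rw [mulVec_sub_mulVec]
  exact abs_sum_mul_le_of_wsum hδ'.le _ x _ (h k aj m2 a h1 h2 h3 h4 h5 h6 M' hM Λ μ x xe hxe) f hF hD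

/-! ## §3 (2.44) for every mesh `j ≥ 0`, and the uniform `ℓ^∞`/`ℓ¹` bounds -/

/-- **[B6] (2.44) FOR THE GENUINE TWO-LEVEL CUBE OPERATOR AT EVERY MESH `L^{−j}`, `j ≥ 0`**:
`|(K(h_□)G′(□)h_□λ)(x)| ≤ O(M^{−1})e^{−δ₀|x−y|}|λ|`.  For every dimension `d + 1`, block size `L = ℓ + 1 ≥ 2` and
window there are `δ′, C > 0` such that for EVERY `j ≥ 0` (`n = L^j`), every point of the window, every box built of
`L`-blocks, every `Λ ⊆ □^{(j)}` that is a union of `L`-blocks, every cut-off `h` with unit-scale Lipschitz constant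
`κ₁ ≥ 0` and unit-scale Laplacian bound `κ₂`, every `g` with `|g| ≤ F` and every `D ≤ dist_∞(x, supp g)`:
`|(K(h)G′(□)g)(x)| ≤ C(κ₁ + κ₂)e^{−δ′D/L^j}F`.  The original `ineq244_twoLevel` with «1 ≤ k» removed: route
`kComm_gTwoLevel_pointwise` with both quantities of (2.43) from §§1–2.  HONEST SCOPE as in the original.
[cite: Balaban1984PropagatorsII, (2.44) p.230; (2.14) p.225 (j = 0 admitted)] -/
theorem ineq244_twoLevel (d ℓ : ℕ) (hℓ : 1 ≤ ℓ) (aminus aplus m2plus a2minus a2plus : ℝ) (ha : 0 < aminus)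
    (ha2 : 0 < a2minus) :
    ∃ δ' C : ℝ, 0 < δ' ∧ 0 < C ∧ ∀ (k : ℕ) (aj m2 a : ℝ), aminus ≤ aj → aj ≤ aplus → 0 ≤ m2 →
      m2 ≤ m2plus → a2minus ≤ a → a ≤ a2plus → ∀ (M' : Fin (d + 1) → ℕ), (∀ i, 1 ≤ M' i) →
        ∀ (Λ : Finset ↥(boxDom (fun i => (ℓ + 1) * M' i))), IsBlockUnion ℓ M' Λ →
        ∀ (h : ↥(boxDom (fun i => (ℓ + 1) ^ k * ((ℓ + 1) * M' i))) → ℝ) (κ₁ κ₂ : ℝ), 0 ≤ κ₁ →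
          (∀ z z' : ↥(boxDom (fun i => (ℓ + 1) ^ k * ((ℓ + 1) * M' i))),
            |h z' - h z| ≤ κ₁ * supNorm (z'.1 - z.1) / (((ℓ + 1) ^ k : ℕ) : ℝ)) →
          (∀ z : ↥(boxDom (fun i => (ℓ + 1) ^ k * ((ℓ + 1) * M' i))),
            |(((ℓ + 1) ^ k : ℕ) : ℝ) ^ 2 * ∑ z' ∈ boxNbrs _ z, (h z' - h z)| ≤ κ₂) →
          ∀ (g : ↥(boxDom (fun i => (ℓ + 1) ^ k * ((ℓ + 1) * M' i))) → ℝ) (F Dd : ℝ), (∀ x', |g x'| ≤ F) →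
          ∀ x : ↥(boxDom (fun i => (ℓ + 1) ^ k * ((ℓ + 1) * M' i))),
            (∀ x', g x' ≠ 0 → Dd ≤ supNorm (x.1 - x'.1)) →
              |(kComm (twoLevelOp ((ℓ + 1) ^ k) ℓ aj a m2 M' Λ) h
                  *ᵥ (gTwoLevel ((ℓ + 1) ^ k) ℓ aj a m2 M' Λ *ᵥ g)) x|
                ≤ C * (κ₁ + κ₂) * Real.exp (-(δ' * Dd / (((ℓ + 1) ^ k : ℕ) : ℝ))) * F := by
  obtain ⟨δ₁, c₁, hδ₁, hc₁, h1⟩ := ineq243_twoLevel_roww d ℓ hℓ aminus aplus m2plus a2minus a2plus ha ha2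
  obtain ⟨δ₂, c₂, hδ₂, hc₂, h2⟩ := ineq243_twoLevel_deriv_wsum d ℓ hℓ aminus aplus m2plus a2minus a2plus ha ha2
  have hδ'pos : 0 < min δ₁ δ₂ := lt_min hδ₁ hδ₂
  refine ⟨min δ₁ δ₂, 2 * (d + 1) * c₂ * Real.exp (min δ₁ δ₂)
    + (|aplus| + |a2plus|) * ((ℓ : ℝ) + 1) * Real.exp (min δ₁ δ₂ * ((ℓ : ℝ) + 1)) * c₁ + c₁,
    hδ'pos, by positivity, ?_⟩
  intro k aj m2 a e1 e2 e3 e4 e5 e6 M' hM Λ hΛ h κ₁ κ₂ hκ₁ hLip hLap g F Dd hF x hD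
  have hn1 : 1 ≤ (ℓ + 1) ^ k := Nat.one_le_pow _ _ (by omega)
  have haj : 0 < aj := lt_of_lt_of_le ha e1
  have ha0 : 0 ≤ a := le_trans ha2.le e5
  have hF0 : 0 ≤ F := (abs_nonneg _).trans (hF x)
  have hκ₂ : 0 ≤ κ₂ := (abs_nonneg _).trans (hLap x)
  have hrow : ∀ z, roww (min δ₁ δ₂) ((ℓ + 1) ^ k) (gTwoLevel ((ℓ + 1) ^ k) ℓ aj a m2 M' Λ) z ≤ c₁ :=
    fun z => (roww_mono (min_le_left _ _) _ _ z).trans (h1 k aj m2 a e1 e2 e3 e4 e5 e6 M' hM Λ z)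
  have hdrow : ∀ (μ : Fin (d + 1)) (z ze : ↥(boxDom (fun i => (ℓ + 1) ^ k * ((ℓ + 1) * M' i)))),
      ze.1 = z.1 + Pi.single μ 1 →
        wsum (min δ₁ δ₂) ((ℓ + 1) ^ k) z (fun x' => ((((ℓ + 1) ^ k : ℕ)) : ℝ)
          * (gTwoLevel ((ℓ + 1) ^ k) ℓ aj a m2 M' Λ ze x' - gTwoLevel ((ℓ + 1) ^ k) ℓ aj a m2 M' Λ z x')) ≤ c₂ := by
    intro μ z ze hze
    refine (wsum_mono (min_le_right _ _) _ z _).trans ?_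
    have := h2 k aj m2 a e1 e2 e3 e4 e5 e6 M' hM Λ μ z ze hze
    rw [wsum]
    exact this
  refine (kComm_gTwoLevel_pointwise hn1 haj ha0 hΛ hδ'pos.le hc₁.le hc₂.le hκ₁ hrow hdrow h hLip hLap
    g hF x hD).trans ?_
  have hE := Real.exp_pos (-(min δ₁ δ₂ * Dd / ((((ℓ + 1) ^ k : ℕ)) : ℝ)))
  have hcoef : 2 * (d + 1) * c₂ * Real.exp (min δ₁ δ₂) * κ₁ + c₁ * κ₂
      + (aj + a) * ((ℓ : ℝ) + 1) * Real.exp (min δ₁ δ₂ * ((ℓ : ℝ) + 1)) * c₁ * κ₁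
      ≤ (2 * (d + 1) * c₂ * Real.exp (min δ₁ δ₂)
        + (|aplus| + |a2plus|) * ((ℓ : ℝ) + 1) * Real.exp (min δ₁ δ₂ * ((ℓ : ℝ) + 1)) * c₁ + c₁) * (κ₁ + κ₂) := by
    have t0 : aj + a ≤ |aplus| + |a2plus| := add_le_add (e2.trans (le_abs_self _)) (e6.trans (le_abs_self _))
    have t1 : (aj + a) * ((ℓ : ℝ) + 1) * Real.exp (min δ₁ δ₂ * ((ℓ : ℝ) + 1)) * c₁ * κ₁
        ≤ (|aplus| + |a2plus|) * ((ℓ : ℝ) + 1) * Real.exp (min δ₁ δ₂ * ((ℓ : ℝ) + 1)) * c₁ * κ₁ := by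
      have h0 : 0 ≤ ((ℓ : ℝ) + 1) * Real.exp (min δ₁ δ₂ * ((ℓ : ℝ) + 1)) * c₁ * κ₁ := by positivity
      nlinarith
    have t2 : 0 ≤ 2 * (d + 1) * c₂ * Real.exp (min δ₁ δ₂) * κ₂ := by positivity
    have t3 : 0 ≤ (|aplus| + |a2plus|) * ((ℓ : ℝ) + 1) * Real.exp (min δ₁ δ₂ * ((ℓ : ℝ) + 1)) * c₁ * κ₂ := by
      positivity
    have t4 : 0 ≤ c₁ * κ₁ := by positivity
    nlinarith
  exact mul_le_mul_of_nonneg_right (mul_le_mul_of_nonneg_right hcoef hE.le) hF0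

/-- the uniform `ℓ^∞ → ℓ^∞` and (by symmetry, `gTwoLevel_isSymm`) `ℓ¹ → ℓ¹` operator bounds of `G′(□)` at every
mesh `j ≥ 0`: with the constants of `ineq243_twoLevel_roww`, `Σ_{x′}|G′(□; x, x′)| ≤ c′` and `Σ_{x}|G′(□; x, x′)| ≤ c′`.
[cite: Balaban1984PropagatorsII, (2.43) p.230] -/
theorem ineq243_twoLevel_rowSum_colSum (d ℓ : ℕ) (hℓ : 1 ≤ ℓ) (aminus aplus m2plus a2minus a2plus : ℝ)
    (ha : 0 < aminus) (ha2 : 0 < a2minus) :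
    ∃ c' : ℝ, 0 < c' ∧ ∀ (k : ℕ) (aj m2 a : ℝ), aminus ≤ aj → aj ≤ aplus → 0 ≤ m2 →
      m2 ≤ m2plus → a2minus ≤ a → a ≤ a2plus → ∀ (M' : Fin (d + 1) → ℕ), (∀ i, 1 ≤ M' i) →
        ∀ (Λ : Finset ↥(boxDom (fun i => (ℓ + 1) * M' i)))
          (x : ↥(boxDom (fun i => (ℓ + 1) ^ k * ((ℓ + 1) * M' i)))),
          ∑ x', |gTwoLevel ((ℓ + 1) ^ k) ℓ aj a m2 M' Λ x x'| ≤ c' ∧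
          ∑ x', |gTwoLevel ((ℓ + 1) ^ k) ℓ aj a m2 M' Λ x' x| ≤ c' := by
  obtain ⟨δ', c', hδ', hc', h⟩ := ineq243_twoLevel_roww d ℓ hℓ aminus aplus m2plus a2minus a2plus ha ha2
  refine ⟨c', hc', ?_⟩
  intro k aj m2 a h1 h2 h3 h4 h5 h6 M' hM Λ x
  have hr := h k aj m2 a h1 h2 h3 h4 h5 h6 M' hM Λ x
  exact ⟨(rowSum_le_roww hδ'.le _ _ x).trans hr,
    (colSum_le_roww hδ'.le _ (gTwoLevel_isSymm _ _ _ _ _ _ _) x).trans hr⟩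

/-! ## §4 Non-vacuity (`d + 1 = 4`, `L = 2`, windows `a_j ∈ [1/2, 2]`, `m² ∈ [0, 1]`, `a ∈ [1/2, 2]`; `k = 0` and `k = 1`) -/

/-- the main estimate at the physical dimension `d + 1 = 4`, `L = 2`, now for every `k ≥ 0`. -/
example : ∃ δ' c' : ℝ, 0 < δ' ∧ 0 < c' ∧ ∀ (k : ℕ) (aj m2 a : ℝ), (1 / 2 : ℝ) ≤ aj → aj ≤ 2 →
    0 ≤ m2 → m2 ≤ 1 → (1 / 2 : ℝ) ≤ a → a ≤ 2 → ∀ (M' : Fin (3 + 1) → ℕ), (∀ i, 1 ≤ M' i) →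
      ∀ (Λ : Finset ↥(boxDom (fun i => (1 + 1) * M' i)))
        (x : ↥(boxDom (fun i => (1 + 1) ^ k * ((1 + 1) * M' i)))),
        roww δ' ((1 + 1) ^ k) (gTwoLevel ((1 + 1) ^ k) 1 aj a m2 M' Λ) x ≤ c' :=
  ineq243_twoLevel_roww 3 1 le_rfl (1 / 2) 2 1 (1 / 2) 2 (by norm_num) (by norm_num)

/-- (2.44) at the physical dimension, every `k ≥ 0`: the quantifier prefix of `ineq244_twoLevel` is met. -/
example : ∃ δ' C : ℝ, 0 < δ' ∧ 0 < C ∧ ∀ (k : ℕ) (aj m2 a : ℝ), (1 / 2 : ℝ) ≤ aj → aj ≤ 2 → 0 ≤ m2 →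
    m2 ≤ 1 → (1 / 2 : ℝ) ≤ a → a ≤ 2 → ∀ (M' : Fin (3 + 1) → ℕ), (∀ i, 1 ≤ M' i) →
      ∀ (Λ : Finset ↥(boxDom (fun i => (1 + 1) * M' i))), IsBlockUnion 1 M' Λ →
      ∀ (h : ↥(boxDom (fun i => (1 + 1) ^ k * ((1 + 1) * M' i))) → ℝ) (κ₁ κ₂ : ℝ), 0 ≤ κ₁ →
        (∀ z z' : ↥(boxDom (fun i => (1 + 1) ^ k * ((1 + 1) * M' i))),
          |h z' - h z| ≤ κ₁ * supNorm (z'.1 - z.1) / (((1 + 1) ^ k : ℕ) : ℝ)) →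
        (∀ z : ↥(boxDom (fun i => (1 + 1) ^ k * ((1 + 1) * M' i))),
          |(((1 + 1) ^ k : ℕ) : ℝ) ^ 2 * ∑ z' ∈ boxNbrs _ z, (h z' - h z)| ≤ κ₂) →
        ∀ (g : ↥(boxDom (fun i => (1 + 1) ^ k * ((1 + 1) * M' i))) → ℝ) (F Dd : ℝ), (∀ x', |g x'| ≤ F) →
        ∀ x : ↥(boxDom (fun i => (1 + 1) ^ k * ((1 + 1) * M' i))),
          (∀ x', g x' ≠ 0 → Dd ≤ supNorm (x.1 - x'.1)) →
            |(kComm (twoLevelOp ((1 + 1) ^ k) 1 aj a m2 M' Λ) h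
                *ᵥ (gTwoLevel ((1 + 1) ^ k) 1 aj a m2 M' Λ *ᵥ g)) x|
              ≤ C * (κ₁ + κ₂) * Real.exp (-(δ' * Dd / (((1 + 1) ^ k : ℕ) : ℝ))) * F :=
  ineq244_twoLevel 3 1 le_rfl (1 / 2) 2 1 (1 / 2) 2 (by norm_num) (by norm_num)

/-- THE NEW MEMBER IS A GENUINE INVERSE: at `k = 0` (`n = (1+1)^0 = 1`, unit mesh), `L = 2`, `a_0 = a = 1`,
`m² = 0`, the unit cube of blocks `M′ ≡ 1` and `Λ` = the whole unit box (a union of `L`-blocks), the two-level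
operator times `G′(□)` is the identity (`twoLevelOp_mul_gTwoLevel`, mesh-free). -/
example : twoLevelOp ((1 + 1) ^ 0) 1 (1 : ℝ) 1 0 (fun _ : Fin (3 + 1) => 1) Finset.univ
    * gTwoLevel ((1 + 1) ^ 0) 1 (1 : ℝ) 1 0 (fun _ : Fin (3 + 1) => 1) Finset.univ = 1 :=
  twoLevelOp_mul_gTwoLevel (by norm_num) le_rfl one_pos one_pos le_rfl (fun _ => le_rfl)
    (fun _ _ y' _ => Finset.mem_univ y')

end

end Literature.MathematicalPhysics.QuantumFieldTheory.Balaban1983to89.B6Ineq243TwoLevelBoxL0
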